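import Literature.NumberTheory.EllipticCurves.Rank1Residual.X11RankOneCertificates.Schema
import Summits.BirchSwinnertonDyer.Rank1Residual.AdditivePotMult.HeegnerIndexRecordsThree
import HarnessLib

/-!
# Leaf X8 (`p = 3` good supersingular, `a_3 = ±3`), print-tier cell `bsd-print-x8` — per-class certificate records: the record schema and its in-kernel recheck

HONEST FRAMING (cell `bsd-print-x8`, run/shared/lean/pub/bsd-print-x8/, D-0131 (2) PRINT TIER, typer
seat ty3; leaf `Rank1Residual.ClassX8 W p := p = 3 ∧ GoodSS W 3 ∧ a_3 ≠ 0` of the partition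
`CornersAll` §1b): the leaf counts only when its CLASS THEOREM is in the kernel BY NAME, flag-free
(PARTITION currency, D-0132). This file books nothing, is not a class theorem, introduces no named
fact and asserts nothing about elliptic curves. It fixes the FORMAT in which the finite
certificate data of the leaf's census cells — ladder row K3/A8: the 217 Cremona isogeny classes of
conductor `N < 5·10⁵`, analytic rank `≤ 1`, that the rank-`≤ 1` census (book230, referee A R243.1)
leaves open at `p = 3` in class X8 (136 theorem-needed + 81 compute-only) — enter the tree as DATA,
one `Record` per class, in the sibling files `CertificateRecords*.lean` (each states `Certified [r₁, …]`,
proved by `decide +kernel`: the kernel re-runs `Record.check` on the literal data). What a record CLAIMS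
about its curve, in the tree's vocabulary, is `Record.Claim` of the sibling file `CertificateClaim.lean` (an
explicit hypothesis, D-0014 style), which also derives from the claim the per-class hypotheses the
cited theorems of the cell consume (`ClassX8`, `Semistable`, `Surj W 3`, the `3`-adic tower, the
`3`-adic valuation of `#Ш_an·∏c_ℓ/#E(ℚ)_tors²`). Pattern and helper functions (imported, not
restated): `Literature/…/X11RankOneCertificates/Schema.lean` (`powMod`, `natVal`,
`isPrimeBelow504100`, `strictlyIncreasing`, `legendreSym`, `invariants`, `c4Of`, `c6Of`, `discOf`,
`countPoints`, `apNaive`) and the cell `b2b-bsdres` record helpers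
`Theorems/Rank1ResidualX10bHeegnerIndexRecords.lean` (`notCM`, `weierstrassEvalZ`) /
`AdditivePotMult/HeegnerIndexRecordsThree.lean` (`isFundDiscNeg`); sibling schemas of the same
shape: `Supersingular/HeegnerIndexRecordsNonSurj.lean`, `Supersingular/DescentLowerBoundRecords.lean`.

## What a `Record` records and what the kernel rechecks (`Record.check`)

For the curve `label` (Cremona, curve 1 of its class; reduced global minimal model `ainvs`):
* `bad = [(q, v_q(N), v_q(Δ), c_q), …]` for every bad prime `q` (increasing). RECHECKED: every `q`
  prime (trial division), `conductor = ∏ q^{v_q(N)}`, `|Δ(ainvs)| = ∏ q^{v_q(Δ)}` with `Δ` RECOMPUTED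
  from the a-invariants, `v_q(N), v_q(Δ) ≥ 1`, `v_2(N) ≤ 8`, and for `q ≥ 5`: `v_q(N) ≤ 2`,
  `v_q(N) = 1 ↔ q ∤ c₄` (Tate) and the model is minimal at `q` (`¬(q⁴ ∣ c₄ ∧ q⁶ ∣ c₆ ∧ q¹² ∣ Δ)`);
  `tamagawa = ∏ c_q`; `sst ↔ every v_q(N) = 1`;
* THE LEAF: `3 ∤ N`, `3 ∤ Δ(ainvs)` (so the integral model is minimal with good reduction at `3`)
  and `a3 = 3 + 1 − #E(𝔽₃) ∈ {3, −3}` RECOMPUTED by point counting (`apNaive`);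
* non-CM: `j(E) = c₄³/Δ` is none of the thirteen CM `j`-invariants (RECHECKED, `notCM`); for rank `1`
  the Mordell–Weil generator `gen = [(X, Y, d)]`, `P = (X/d², Y/d³)` (Cremona `allgens`, re-saturated
  by PARI) lies on the curve EXACTLY (`weierstrassEvalZ`);
* the mod-`3` image: `surj3 = true` requires `s4Witness = [ℓ_a, ℓ_b]`, odd primes `5 ≤ ℓ < 200`,
  such that the monic integer quartic `f(X) = 27ψ₃(X/3) = X⁴ + b₂X³ + 9b₄X² + 27b₆X + 27b₈` (the
  `3`-division polynomial `ψ₃ = 3x⁴ + b₂x³ + 3b₄x² + 3b₆x + b₈`, Silverman *AEC* Ex. 3.7, rescaled;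
  its four roots are the `3·x`-coordinates of the points of order `3`, i.e. the four lines of `E[3]`)
  has NO ROOT IN `𝔽_{ℓ_a²}` (brute force over `𝔽_{ℓ_a}[t]/(t² − n)`, `n` the least non-residue) —
  so `f mod ℓ_a` is an irreducible, hence separable, quartic and `Frob_{ℓ_a}` is a `4`-cycle on the
  lines (Dedekind) — and EXACTLY ONE ROOT in `𝔽_{ℓ_b}`, a simple one — so `f ≡ (X − r)·g` with `g` an
  irreducible cubic prime to `X − r`, and `Frob_{ℓ_b}` is a `3`-cycle. A subgroup of `S₄` with a
  `4`-cycle and a `3`-cycle has order divisible by `12` and is not `A₄`, so `Gal(f/ℚ) = S₄`: the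
  projective image of `ρ̄_{E,3}` is all of `PGL₂(𝔽₃) ≅ S₄`, which no proper subgroup of `GL₂(𝔽₃)`
  attains (the maximal ones `B(3)`, `N_s(3)`, `N_{ns}(3)` have projective images of order `6, 4, 8`;
  Zywina, arXiv:1508.07660 Thm. 1.2), i.e. `ρ̄_{E,3}` is onto. `surj3 = false` requires
  `resolventRoot = [y₀]` with `R_f(y₀) = 0`, `R_f` the cubic resolvent of `f`: then `Gal(f) ≤ D₄`, the
  projective image is proper, `ρ̄_{E,3}` is not onto. Also RECHECKED: `1 ∈ isogDegrees`, `3 ∤ d` for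
  every isogeny degree `d` (no rational `3`-isogeny), `gal3Order = 24 ↔ surj3` (PARI's `polgalois`);
* `frob9 = [(ℓ, a_ℓ)]` (optional): a good odd prime `ℓ ≡ 2, 5 (mod 9)` with `a_ℓ ≡ 3, 6 (mod 9)`,
  `a_ℓ` RECOMPUTED by point counting — with surj(3) this gives `ρ̄_{E,3ⁿ}` onto for every `n`
  (`WeierstrassCurve.forall_hasSurjectiveModNGaloisRep_three_pow_of_frobenius`); on the leaf it is
  redundant (Wuthrich 2014 Lemma 20 at the good prime `3`, PROVED in the tree) but independent;
* invariants: `rank ≤ 1` (analytic = Mordell–Weil rank, engines T/P), `rootNumber = (−1)^rank`,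
  `3 ∤ torsion`, `shaAn` a positive square, `ord3Tam = v₃(tamagawa)`, `ord3Sha = v₃(shaAn)`,
  `ord3Quot = ord3Sha + ord3Tam` (`= ord₃(#Ш_an·∏c_q/#T²)` as `3 ∤ #T`); `kind` (the census verdict:
  `X8` theorem-needed / `X8~` compute-only / `X1a,X8`, `X11b,X8` double residue) is documentation.
NOT checked here (CLAIMS, `Claim.lean`): that `ainvs` is Cremona's curve `label` and globally
minimal at `2`, that `N` is the conductor and the `c_q` are the Tamagawa numbers, the analytic
rank, `#E(ℚ)_tors`, `#Ш_an`, the modular degree, and the Galois statements themselves.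

A `TwistRecord` is the Heegner-field datum of the anticyclotomic (twist-certificate) road: a
fundamental `D < 0` with `3 ∤ D`, `(D, N) = 1`, `hw² ≡ D (mod 4N)` (every prime of `N` splits in
`K = ℚ(√D)`), `split3 ↔ D ≡ 1 (mod 3)` (`3` split, else inert, in `K`), the reduced minimal model
`Fainvs` of the twist `E^D` with `FN = N·D²`, a twist witness `tw` (`j(F) = j(E) ∉ {0, 1728}` and
`c₆(F)c₄(E)c₄(F)c₆(E)·D = tw² ≠ 0`, which forces `F ≅ E^D`), `a₃(F) = (D|3)·a₃(E)` by point count,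
and the twist's rank / torsion / Tamagawa / `#Ш_an` bookkeeping (`Frank + rank(E) = 1`). All
RECHECKED except the engine values (`Frank`, `Ftorsion`, `Ftamagawa`, `FshaAn`; `FshaAn = 0` means
"not determined by the engines").

Design: plain computable data, naive arithmetic, `decide +kernel` (kernel evaluation; no `native_decide`,
no instance, no axiom). Engines of the data files: T = Cremona's ecdata tables (allcurves, allbsd,
allgens, allisog, alldegphi, galrep); P = PARI/GP 2.15 via cypari2 on the compute pool (kit tag
`bsd`; job ids in each record's `engines`). References: Silverman *AEC* III.1, Ex. 3.7, VII.5.1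
[SilvermanAEC2009]; Zywina 2015 Thm. 1.2 [Zywina2015]; Serre 1972 [Serre1972]; Elkies 2006
[Elkies2006]; Wuthrich 2014 Lemma 20 [Wuthrich2014]; Cox, *Primes of the form x² + ny²*, §3.C
(Heegner condition) [Cox2013]; Cremona's tables [Cremona2006].
-/

namespace Summit.BirchSwinnertonDyer.Rank1Residual.PrintX8

open Literature.NumberTheory.EllipticCurves.Rank1Residual.X11RankOneCertificates (powMod natVal
  isPrimeBelow504100 strictlyIncreasing legendreSym invariants c4Of c6Of discOf countPoints apNaive)
open Summit.BirchSwinnertonDyer.BirchSwinnertonDyer.Rank1Residual.HeegnerIndexRecords (notCM weierstrassEvalZ)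
open Summit.BirchSwinnertonDyer.Rank1Residual.AdditivePotMult.HeegnerIndexRecords (isFundDiscNeg)

/-- One certificate record of a census cell of class X8 (one Cremona isogeny class at `p = 3`); see the
module docstring for the meaning of each field. A record asserts nothing; `Record.check` is its
decidable recheck. [folklore] -/
structure Record where
  /-- Cremona label of the curve (curve 1 of its isogeny class, e.g. `"2534f1"`). -/
  label : String
  /-- census verdict of the cell: `"X8"` theorem-needed, `"X8~"` compute-only, `"X1a,X8"` / `"X11b,X8"`. -/
  kind : String
  /-- a-invariants `[a₁, a₂, a₃, a₄, a₆]` of the reduced global minimal model. -/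
  ainvs : List ℤ
  /-- the conductor `N` (`3 ∤ N`). -/
  conductor : ℕ
  /-- `(q, v_q(N), v_q(Δ_min), c_q)` for every bad prime `q`, increasing in `q`. -/
  bad : List (ℕ × ℕ × ℕ × ℕ)
  /-- `N` square-free. -/
  sst : Bool
  /-- `a_3 ∈ {3, −3}`. -/
  a3 : ℤ
  /-- analytic rank `= ` Mordell–Weil rank (`0` or `1`). -/
  rank : ℕ
  /-- global root number. -/
  rootNumber : ℤ
  /-- rank `1`: the Mordell–Weil generator `[(X, Y, d)]`, `P = (X/d², Y/d³)`; rank `0`: `[]`. -/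
  gen : List (ℤ × ℤ × ℕ)
  /-- `#E(ℚ)_tors`. -/
  torsion : ℕ
  /-- `∏_q c_q`. -/
  tamagawa : ℕ
  /-- the analytic order of `Ш` (an integer square; engines T and P agree). -/
  shaAn : ℕ
  /-- `v₃(∏ c_q)`. -/
  ord3Tam : ℕ
  /-- `v₃(#Ш_an)`. -/
  ord3Sha : ℕ
  /-- `v₃(#Ш_an · ∏ c_q / #T²)`. -/
  ord3Quot : ℕ
  /-- degrees of the rational isogenies from the curve (Cremona `allisog`; PARI `ellisomat`), `1` included. -/
  isogDegrees : List ℕ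
  /-- modular degree of the curve (Cremona `alldegphi`; engine T only). -/
  modDegree : ℕ
  /-- Cremona/Sutherland image codes at the non-surjective primes of the curve (documentation). -/
  galrep : List String
  /-- `ρ̄_{E,3}` surjective (certified by `s4Witness`) or not (certified by `resolventRoot`). -/
  surj3 : Bool
  /-- `[ℓ_a, ℓ_b]`: `f = 27ψ₃(X/3)` has no root in `𝔽_{ℓ_a²}` and exactly one simple root in `𝔽_{ℓ_b}`; or `[]`. -/
  s4Witness : List ℕ
  /-- `[y₀]` with `R_f(y₀) = 0` (cubic resolvent), or `[]`. -/
  resolventRoot : List ℤ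
  /-- `[(ℓ, a_ℓ)]` with `ℓ ≡ 2, 5 (mod 9)` good, `a_ℓ ≡ 3, 6 (mod 9)`, or `[]`. -/
  frob9 : List (ℕ × ℤ)
  /-- order of `Gal(ψ₃/ℚ)` by PARI `polgalois` (`24` = `S₄`; documentation, tied to `surj3`). -/
  gal3Order : ℕ
  /-- provenance strings (engines, kit job ids); documentation only. -/
  engines : List String

/-! ### Naive arithmetic for the `3`-division certificate (kernel-evaluable) -/

/-- Coefficients, constant term first, of `f(X) = 27·ψ₃(X/3) = X⁴ + b₂X³ + 9b₄X² + 27b₆X + 27b₈`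
(`ψ₃ = 3x⁴ + b₂x³ + 3b₄x² + 3b₆x + b₈`). [cite: SilvermanAEC2009, Exercise 3.7 (division polynomials)] -/
def psi3Monic (a : List ℤ) : List ℤ :=
  let t := invariants a
  [27 * t.2.2.2.1, 27 * t.2.2.1, 9 * t.2.1, t.1, 1]

/-- Value mod `ℓ` (in `[0, ℓ)`) of the integer polynomial with coefficient list `f` (constant first) at `x`. [folklore] -/
def polyEvalMod (f : List ℤ) (x : ℤ) (ℓ : ℕ) : ℤ := f.foldr (fun c acc => (acc * x + c) % (ℓ : ℤ)) 0

/-- Coefficient list of the derivative. [folklore] -/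
def polyDeriv (f : List ℤ) : List ℤ :=
  List.zipWith (fun c (i : ℕ) => c * ((i : ℤ) + 1)) (f.drop 1) (List.range f.length)

/-- The residues `a mod ℓ` at which `f` vanishes. [folklore] -/
def rootsMod (f : List ℤ) (ℓ : ℕ) : List ℕ := (List.range ℓ).filter fun a => polyEvalMod f a ℓ == 0

/-- `f` has exactly one root in `𝔽_ℓ`, and it is simple. [folklore] -/
def oneSimpleRoot (f : List ℤ) (ℓ : ℕ) : Bool :=
  match rootsMod f ℓ with
  | [a] => polyEvalMod (polyDeriv f) a ℓ != 0
  | _ => false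

/-- The least quadratic non-residue in `[2, ℓ)` (`0` if none, junk). [folklore] -/
def leastNonResidue (ℓ : ℕ) : ℕ :=
  ((List.range ℓ).find? fun (m : ℕ) => decide (2 ≤ m) && (legendreSym (m : ℤ) ℓ == -1)).getD 0

/-- Product in `𝔽_ℓ[t]/(t² − n)` of `a.1 + a.2·t` and `b.1 + b.2·t` (representatives in `[0, ℓ)`). [folklore] -/
def fl2Mul (ℓ n : ℕ) (a b : ℕ × ℕ) : ℕ × ℕ :=
  ((a.1 * b.1 + a.2 * b.2 * n) % ℓ, (a.1 * b.2 + a.2 * b.1) % ℓ)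

/-- Value in `𝔽_{ℓ²} = 𝔽_ℓ[t]/(t² − n)` of the integer polynomial `f` at `z` (Horner). [folklore] -/
def polyEvalFl2 (f : List ℤ) (ℓ n : ℕ) (z : ℕ × ℕ) : ℕ × ℕ :=
  f.foldr (fun c acc => let w := fl2Mul ℓ n acc z; ((((w.1 : ℤ) + c) % (ℓ : ℤ)).toNat, w.2)) (0, 0)

/-- `f` has no root in `𝔽_{ℓ²}` (odd prime `ℓ`; brute force over `ℓ²` elements). [folklore] -/
def noRootFl2 (f : List ℤ) (ℓ : ℕ) : Bool :=
  let n := leastNonResidue ℓ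
  decide (2 ≤ n) && (List.range ℓ).all fun u => (List.range ℓ).all fun v =>
    let w := polyEvalFl2 f ℓ n (u, v); !(w.1 == 0 && w.2 == 0)

/-- The cubic resolvent `R_f(y) = y³ − a₂y² + (a₁a₃ − 4a₀)y − (a₁² + a₀a₃² − 4a₀a₂)` of the monic
quartic `f = [a₀, a₁, a₂, a₃, 1]`, evaluated at `y` (junk `1` otherwise). Its roots are the
`rᵢrⱼ + rₖrₗ`; a rational root means `Gal(f) ≤ D₄`. [cite: DummitFoote2004, §14.6 (the resolvent cubic)] -/
def resolventEval (f : List ℤ) (y : ℤ) : ℤ :=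
  match f with
  | [a0, a1, a2, a3, 1] => y ^ 3 - a2 * y ^ 2 + (a1 * a3 - 4 * a0) * y - (a1 * a1 + a0 * a3 * a3 - 4 * a0 * a2)
  | _ => 1

/-! ### The recheck of a `Record` -/

namespace Record

variable (r : Record)

/-- Shape, support and local consistency (module docstring, first bullet). [cite: SilvermanAEC2009, Prop. VII.5.1 and Rem. VII.1.1] -/
def checkSupport : Bool :=
  (r.ainvs.length == 5) && decide (discOf r.ainvs ≠ 0) &&
  r.bad.all (fun t => isPrimeBelow504100 t.1 && decide (1 ≤ t.2.1) && decide (1 ≤ t.2.2.1)) &&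
  strictlyIncreasing (r.bad.map (·.1)) &&
  ((r.bad.map fun t => t.1 ^ t.2.1).foldl (· * ·) 1 == r.conductor) &&
  (((r.bad.map fun t => t.1 ^ t.2.2.1).foldl (· * ·) 1 : ℕ) == (discOf r.ainvs).natAbs) &&
  ((r.bad.map fun t => t.2.2.2).foldl (· * ·) 1 == r.tamagawa) &&
  (r.sst == r.bad.all fun t => t.2.1 == 1) &&
  r.bad.all (fun t => (t.1 == 2 && decide (t.2.1 ≤ 8)) || (decide (5 ≤ t.1) && decide (t.2.1 ≤ 2) &&
    ((t.2.1 == 1) == decide (c4Of r.ainvs % (t.1 : ℤ) ≠ 0)) &&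
    !(decide (c4Of r.ainvs % (t.1 : ℤ) ^ 4 = 0) && decide (c6Of r.ainvs % (t.1 : ℤ) ^ 6 = 0) && decide (12 ≤ t.2.2.1))))

/-- THE LEAF: `3 ∤ N`, `3 ∤ Δ(ainvs)`, `a3 = a_3` by point count, `a_3 = ±3`; and non-CM. [folklore] -/
def checkLeaf : Bool :=
  decide (r.conductor % 3 ≠ 0) && decide (discOf r.ainvs % 3 ≠ 0) && (apNaive r.ainvs 3 == r.a3) &&
  (r.a3 == 3 || r.a3 == -3) && notCM r.ainvs

/-- The mod-`3` image certificate (module docstring): `S₄` witnesses when `surj3`, a resolvent root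
otherwise; no rational `3`-isogeny; `gal3Order = 24 ↔ surj3`. [cite: Zywina2015, Thm. 1.2 (ℓ = 3)] -/
def checkImage : Bool :=
  let f := psi3Monic r.ainvs
  r.isogDegrees.contains 1 && r.isogDegrees.all (fun d => decide (d % 3 ≠ 0)) &&
  ((r.gal3Order == 24) == r.surj3) &&
  (if r.surj3 then
    (match r.s4Witness with
      | [la, lb] => decide (5 ≤ la ∧ la < 200 ∧ 5 ≤ lb ∧ lb < 200) && isPrimeBelow504100 la &&
          isPrimeBelow504100 lb && noRootFl2 f la && oneSimpleRoot f lb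
      | _ => false) && r.resolventRoot.isEmpty
  else
    (match r.resolventRoot with
      | [y] => resolventEval f y == 0
      | _ => false) && r.s4Witness.isEmpty)

/-- The optional `3`-adic Frobenius witness: `ℓ ≡ 2, 5 (mod 9)` a good odd prime `< 300`,
`a_ℓ` recomputed, `a_ℓ ≡ 3, 6 (mod 9)`. [cite: Elkies2006, Introduction] -/
def checkFrob9 : Bool :=
  decide (r.frob9.length ≤ 1) &&
  r.frob9.all fun t => decide (5 ≤ t.1 ∧ t.1 < 300) && isPrimeBelow504100 t.1 &&
    decide (r.conductor % t.1 ≠ 0) && (t.1 % 9 == 2 || t.1 % 9 == 5) && (apNaive r.ainvs t.1 == t.2) &&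
    (t.2 % 9 == 3 || t.2 % 9 == 6)

/-- Invariants and `3`-adic bookkeeping (module docstring). [folklore] -/
def checkInvariants : Bool :=
  decide (r.rank ≤ 1) && (r.rootNumber == (if r.rank == 0 then 1 else -1)) && decide (0 < r.torsion) &&
  (r.gen.length == r.rank) && r.gen.all (fun g => decide (1 ≤ g.2.2) && (weierstrassEvalZ r.ainvs g.1 g.2.1 g.2.2 == 0)) &&
  decide (r.torsion % 3 ≠ 0) && decide (0 < r.shaAn) && (List.range 1000).any (fun k => k * k == r.shaAn) &&
  decide (0 < r.tamagawa) && (r.ord3Tam == natVal 3 r.tamagawa) && (r.ord3Sha == natVal 3 r.shaAn) &&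
  (r.ord3Quot == r.ord3Sha + r.ord3Tam) && decide (0 < r.modDegree)

/-- The full recheck of a record. [folklore] -/
def check : Bool := r.checkSupport && r.checkLeaf && r.checkImage && r.checkFrob9 && r.checkInvariants

end Record

/-- A list of records is `Certified` when every one passes `Record.check`: the statement of each
data theorem `theorem certified… : Certified [ … ] := by decide +kernel` of the files `Records*.lean`. (An
`abbrev` of a `Bool` equation, so `decide` needs no instance.) [folklore] -/
abbrev Certified (rs : List Record) : Prop := rs.all Record.check = true

/-- Unpacking `Certified`: every listed record passes the recheck. [folklore] -/
theorem Certified.check_of_mem {rs : List Record} (h : Certified rs) {r : Record} (hr : r ∈ rs) :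
    r.check = true :=
  List.all_eq_true.1 h r hr

/-- Projections of a passing recheck. [folklore] -/
theorem Record.checks_of_check (r : Record) (h : r.check = true) :
    r.checkSupport = true ∧ r.checkLeaf = true ∧ r.checkImage = true ∧ r.checkFrob9 = true ∧
      r.checkInvariants = true := by
  simp only [Record.check, Bool.and_eq_true] at h
  exact ⟨h.1.1.1.1, h.1.1.1.2, h.1.1.2, h.1.2, h.2⟩

/-- A passing record has `a3 = 3 ∨ a3 = −3`, `3 ∤ conductor`, `rank ≤ 1`, `3 ∤ torsion`. [folklore] -/
theorem Record.leaf_of_check (r : Record) (h : r.check = true) :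
    (r.a3 = 3 ∨ r.a3 = -3) ∧ ¬ 3 ∣ r.conductor ∧ r.rank ≤ 1 ∧ ¬ 3 ∣ r.torsion := by
  obtain ⟨-, hl, -, -, hi⟩ := r.checks_of_check h
  simp only [Record.checkLeaf, Bool.and_eq_true, decide_eq_true_eq, Bool.or_eq_true, beq_iff_eq] at hl
  simp only [Record.checkInvariants, Bool.and_eq_true, decide_eq_true_eq] at hi
  exact ⟨hl.1.2, by omega, by omega, by omega⟩

/-- A passing record has `ord3Quot = ord3Sha + ord3Tam`, `ord3Sha = v₃(shaAn)`, `ord3Tam = v₃(tamagawa)`. [folklore] -/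
theorem Record.ord3_of_check (r : Record) (h : r.check = true) :
    r.ord3Quot = r.ord3Sha + r.ord3Tam ∧ r.ord3Sha = natVal 3 r.shaAn ∧ r.ord3Tam = natVal 3 r.tamagawa := by
  obtain ⟨-, -, -, -, hi⟩ := r.checks_of_check h
  simp only [Record.checkInvariants, Bool.and_eq_true, decide_eq_true_eq, beq_iff_eq] at hi
  exact ⟨by omega, by omega, by omega⟩

/-! ### Heegner twist data -/

/-- One Heegner-field datum of an X8 cell: the field `K = ℚ(√D)` and the quadratic twist `E^D` (module
docstring). Asserts nothing; `TwistRecord.check` is its decidable recheck. [folklore] -/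
structure TwistRecord where
  /-- Cremona label of the X8 curve `E`. -/
  label : String
  /-- a-invariants of `E` (as in its `Record`). -/
  ainvs : List ℤ
  /-- conductor of `E`. -/
  conductor : ℕ
  /-- the discriminant `D < 0` of `K` (fundamental, `3 ∤ D`, `(D, N) = 1`). -/
  D : ℤ
  /-- factorisation `[(q, e), …]` of `|D|`, increasing. -/
  Dfactors : List (ℕ × ℕ)
  /-- a square root of `D` modulo `4N` (Heegner condition: every prime of `N` splits in `K`). -/
  hw : ℕ
  /-- `3` splits in `K` (`D ≡ 1 (mod 3)`); `false` = `3` inert (`D ≡ 2 (mod 3)`). -/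
  split3 : Bool
  /-- a-invariants of the reduced minimal model `F` of the twist `E^D`. -/
  Fainvs : List ℤ
  /-- Cremona label of `F` when `N_F < 5·10⁵`, else `""`. -/
  Flabel : String
  /-- conductor `N_F = N·D²`. -/
  FN : ℕ
  /-- twist witness: `c₆(F)c₄(E)c₄(F)c₆(E)·D = tw²`. -/
  tw : ℤ
  /-- analytic rank of `F` (`= 1 − rank E`). -/
  Frank : ℕ
  /-- `#F(ℚ)_tors`. -/
  Ftorsion : ℕ
  /-- `∏_q c_q(F)`. -/
  Ftamagawa : ℕ
  /-- `#Ш_an(F)` (`0` = not determined). -/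
  FshaAn : ℕ
  /-- `v₃(#Ш_an(F)·∏c_q(F))` (meaningful when `FshaAn ≠ 0`). -/
  Ford3Quot : ℕ
  /-- provenance strings; documentation only. -/
  engines : List String

/-- `F` is the twist of `E` by `D`: `c₄(E), c₆(E) ≠ 0` (so `j ∉ {0, 1728}`), `j(F) = j(E)` and
`c₆(F)c₄(E)c₄(F)c₆(E)·D` is the non-zero square `tw²` (if `F = E^d`, `c₄(F) = u⁴d²c₄(E)`,
`c₆(F) = u⁶d³c₆(E)`, the product is `(u⁵d²c₄c₆)²·dD`, so `dD` is a square). [cite: SilvermanAEC2009, X.5.4 and III.1 (twists, c-invariants)] -/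
def isTwistBy (a F : List ℤ) (D tw : ℤ) : Bool :=
  decide (c4Of a ≠ 0) && decide (c6Of a ≠ 0) && (F.length == 5) &&
  (c4Of F ^ 3 * discOf a == c4Of a ^ 3 * discOf F) && decide (tw ≠ 0) &&
  (c6Of F * c4Of a * c4Of F * c6Of a * D == tw ^ 2)

namespace TwistRecord

variable (t : TwistRecord)

/-- The recheck of a twist datum (module docstring). [folklore] -/
def check : Bool :=
  (t.ainvs.length == 5) && isFundDiscNeg t.D t.Dfactors && decide (t.D ≤ -7) && decide (t.D % 3 ≠ 0) &&
  (t.split3 == (t.D % 3 == 1)) && decide (0 < t.conductor) && (Int.gcd t.D t.conductor == 1) &&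
  decide (((t.hw : ℤ) ^ 2 - t.D) % (4 * (t.conductor : ℤ)) = 0) &&
  (t.FN == t.conductor * t.D.natAbs * t.D.natAbs) && isTwistBy t.ainvs t.Fainvs t.D t.tw &&
  decide (discOf t.Fainvs % 3 ≠ 0) &&
  (apNaive t.Fainvs 3 == (if t.split3 then apNaive t.ainvs 3 else -apNaive t.ainvs 3)) &&
  decide (t.Frank ≤ 1) && decide (0 < t.Ftorsion) && decide (t.Ftorsion % 3 ≠ 0) && decide (0 < t.Ftamagawa) &&
  (t.FshaAn == 0 || ((List.range 1000).any (fun k => k * k == t.FshaAn) &&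
    (t.Ford3Quot == natVal 3 t.FshaAn + natVal 3 t.Ftamagawa)))

end TwistRecord

/-- A list of twist data is `TwistCertified` when every one passes `TwistRecord.check`. [folklore] -/
abbrev TwistCertified (ts : List TwistRecord) : Prop := ts.all TwistRecord.check = true

/-- Unpacking `TwistCertified`. [folklore] -/
theorem TwistCertified.check_of_mem {ts : List TwistRecord} (h : TwistCertified ts) {t : TwistRecord}
    (ht : t ∈ ts) : t.check = true :=
  List.all_eq_true.1 h t ht

-- `decide` unfolds trial division over `List.range 710`, point counts over `List.range ℓ` and the
-- `𝔽_{ℓ²}` root search over `ℓ²` pairs; the default recursion depth is too small for these literals.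
set_option maxRecDepth 100000

/-- SAMPLE (and regression test of the recheck): the record of `2534f1 @ 3` (`N = 2·7·181`
semistable, `a₃ = 3`, rank `0`, `#Ш_an = 9`, `∏c = 1`, `ρ̄_{E,3}` onto with `S₄` witnesses
`ℓ_a = 5` (`f` irreducible mod `5`) and `ℓ_b = 13` (type `(1)(3)`), `3`-adic witness `(23, −6)`)
passes. Engines: T = Cremona ecdata; P = PARI/cypari2, kit jobs j278932 (smoke) / j278971 (all 217 cells). [folklore] -/
theorem certified_sample : Certified [
  { label := "2534f1", kind := "X8", ainvs := [1, -1, 1, -303, -1955], conductor := 2534,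
    bad := [(2, 1, 1, 1), (7, 1, 5, 1), (181, 1, 1, 1)], sst := true, a3 := 3, rank := 0, rootNumber := 1,
    gen := [], torsion := 1, tamagawa := 1, shaAn := 9, ord3Tam := 0, ord3Sha := 2, ord3Quot := 2,
    isogDegrees := [1], modDegree := 1260, galrep := [], surj3 := true, s4Witness := [5, 13],
    resolventRoot := [], frob9 := [(23, -6)], gal3Order := 24,
    engines := ["T", "P:j278971"] } ] := by
  decide +kernel

/-- Tampering is caught: the same record with `a3 := -3` fails (the kernel counts `#E(𝔽₃) = 1`,
so `a₃ = +3`). [folklore] -/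
theorem not_certified_tampered : ¬ Certified [
  { label := "2534f1", kind := "X8", ainvs := [1, -1, 1, -303, -1955], conductor := 2534,
    bad := [(2, 1, 1, 1), (7, 1, 5, 1), (181, 1, 1, 1)], sst := true, a3 := -3, rank := 0, rootNumber := 1,
    gen := [], torsion := 1, tamagawa := 1, shaAn := 9, ord3Tam := 0, ord3Sha := 2, ord3Quot := 2,
    isogDegrees := [1], modDegree := 1260, galrep := [], surj3 := true, s4Witness := [5, 13],
    resolventRoot := [], frob9 := [(23, -6)], gal3Order := 24, engines := [] } ] := by
  decide +kernel

end Summit.BirchSwinnertonDyer.Rank1Residual.PrintX8
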